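import Literature.NumberTheory.Automorphic.Liu2021.Def411WeilCarriersIrreducibleOfReference
import Literature.NumberTheory.GelbartRogawski1991.UnitaryDualPairLocalReferenceSection
import Literature.NumberTheory.GelbartRogawski1991.UnitaryDualPairSeesawContinuity
import Literature.NumberTheory.Automorphic.UnitaryGroupFinAdelicCenterLocal
import HarnessLib

/-!
# Irreducibility of [Liu2021, Def. 4.11]'s `ω(μ, ε, χ)` REDUCED to the place-assembled Weil representation of `U(V ⊗ ⟨lineOf ε⟩)`

Topic `NumberTheory/Automorphic/Liu2021`.  Theorems only (no definition, no record, no named fact, no `sorry`).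

[Liu2021, Def. 4.11 (`FJcycle.tex` l. 2092–2096)] calls `ω(μ, ε, χ) := ⊗'_v ω(μ_v, ε_v, χ_v)` «an irreducible admissible
representation»; `ω(μ_v, ε_v, χ_v)` is the maximal quotient of the Weil representation of `U(V_{ε_v})` (along `ι_{μ_v}`)
on which the CENTRE `E_v¹` acts by `χ_v` (App. D §D.1 Step 3, l. 5221), and its irreducibility is
[Liu2021, App. D Lem. D.1 (l. 5227)].  In the tree, `Def411WeilCarriers.omega … (hs) ε χ` / `rho … (hs) ι ε χ` is the space of
`χ_W`-coinvariants of the finite Weil representation of the dual pair `U(J_V) × U(⟨lineOf ε⟩)` through an ABSTRACT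
compatible splitting family `s` ([GelbartRogawski1991, Prop. 3.1.1]) — the carrier of the binder `hirr` of the Hodge/COR-CM
transposition displays.  Composing

* `Def411WeilCarriersIrreducibleOfReference.lean` (`hirr` does not see `s`: it is a question about ANY reference section),
* `GelbartRogawski1991/UnitaryDualPairLocalReferenceSection.lean` (a reference section ASSEMBLED FROM LOCAL SPLITTINGS `𝓢` of
  the big group `U(J_{VW})`, `J_{VW} = reindex e e (J_V ⊗ₖ J_W)`, whose finite Weil representation is the place-assembled
  `Ω = ⊗'_v ω_v` read on the pair), and
* the centre `E¹(𝔸_{F,f}) → U(J_{VW})(𝔸_{F,f})` (`UnitaryGroup.finAdelicCenter`; for a LINE `W` the `U(J_W)`-member of the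
  pair IS the centre: `finPairEmb_one_finAdelicCenter` of `UnitaryGroupFinAdelicCenterLocal.lean`),

this file proves:

* §1 `WeilCoinv.continuous_localRefSection`, `exists_twist_localRefSection_continuous` — the twist character comparing the
  pair splitting with the local reference section exists and is continuous;
  `WeilCoinv.isIrreducible_weilCoinv_iff_omega_finPairEmb` — `Ω(s, χ')` is irreducible iff the `U(J_V)(𝔸_f)`-action
  `k ↦ Ω(reindex (k ⊗ 1))` on the `χ''`-coinvariants of `u ↦ Ω(reindex (1 ⊗ u))` is (any `N`, `M`);
* §2 (lines, `M = 1`) `WeilCoinv.isIrreducible_weilCoinv_iff_omega_center` — the same with the acting group the CENTRE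
  `E¹(𝔸_{F,f})` of `U(J_{VW})(𝔸_{F,f})` through `Ω ∘ finAdelicCenter`, character `χ'' ∘ (u ↦ u·1_W)`;
* §3 **`Def411WeilCarriers.rho_isIrreducible_of_omega_center`** — for `ι : G →* U(J_V)(𝔸_{F,f})` onto (the diagonal frame
  of the face datum): IF for every CONTINUOUS character `χ₁` of `E¹(𝔸_{F,f})` the `U(J_V)(𝔸_{F,f})`-action on «the maximal
  quotient of `Ω = ⊗'_v ω_v` on which the centre acts by `χ₁`» is irreducible, THEN `rho … ι ε χ` is irreducible — i.e. the
  END displays' `hirr` follows from a statement about the PLACE-ASSEMBLED Weil representation of `U(V ⊗ ⟨lineOf ε⟩)`, which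
  `FinLocalSplittings.omega_centralCoinv_isIrreducible` (`FiniteAdelicWeilCentralCoinvariantsIrreducible.lean`) delivers from
  [Liu2021, Lem. D.1 (l. 5227)] place by place + the survival of the unramified vector, once the centre is decomposed place by place.

DISPLAYED DATA: the local splittings `𝓢` of `U(J_{VW})(F_v)` (Liu's `ι_{μ_v}`, [GelbartRogawski1991, Prop. 3.1.1 p. 455
L1–3]) — a `FinLocalSplittings` term to be instantiated, exactly as in `FiniteAdelicSplittingAssembly.lean`.  Nothing of
[Liu2021] is asserted; HC_CM is not mentioned by this file.

## References
* [Liu2021] Y. Liu, Camb. J. Math. 9 (2021) = arXiv:2102.11518: Def. 4.11 (l. 2083–2097), App. D §D.1 Steps 1∕2∕3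
  (l. 5217∕5219∕5221), Lem. D.1 (l. 5227; (1) l. 5229 for non-vanishing).
* [GelbartRogawski1991] S. Gelbart, J. Rogawski, Invent. Math. 105 (1991), §3.1 p. 454 L21–33, Prop. 3.1.1 p. 455 L1–3,
  Remark p. 457 L4–13.
* [Mok2014] C. P. Mok, Mem. AMS 235 (2015), §1 Notation p. 5 (`U(1)` = centre of `U(N)`).
-/

set_option autoImplicit false

noncomputable section

open scoped Matrix Kronecker TensorProduct Classical
open NumberField NumberField.mixedEmbedding IsDedekindDomain
open Literature.NumberTheory.Automorphic Literature.NumberTheory.Automorphic.UnitaryGroup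
open Literature.NumberTheory.Weil1964 Literature.RepresentationTheory
open Literature.RepresentationTheory.HeisenbergGroup

/-! ## §0 Continuity of the finite-adelic pair embedding -/

namespace Literature.NumberTheory.Automorphic.UnitaryGroup

variable (F E : Type) [Field F] [NumberField F] [Field E] [NumberField E] [Algebra F E]
variable (c : E ≃ₐ[F] E) (N M : ℕ) {n : ℕ} (e : Fin N × Fin M ≃ Fin n)
variable (JV : Matrix (Fin N) (Fin N) E) (JW : Matrix (Fin M) (Fin M) E)

omit [NumberField F] in
/-- the finite-adelic pair embedding is continuous. [cite: GelbartRogawski1991, §3.2 p. 457] -/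
theorem continuous_finPairEmb : Continuous (finPairEmb F E c N M e JV JW) :=
  Continuous.subtype_mk ((continuous_reindexGL e).comp (continuous_kroneckerGL.comp
    (continuous_subtype_val.prodMap continuous_subtype_val))) _

end Literature.NumberTheory.Automorphic.UnitaryGroup

namespace Literature.NumberTheory.GelbartRogawski1991.UnitaryDualPair.WeilCoinv

/-! ## §1 The twist against the local reference section; `Ω(s, χ')` vs the coinvariants of `Ω ∘ finPairEmb` -/

section General

variable (F E : Type) [Field F] [NumberField F] [Field E] [NumberField E] [Algebra F E]
variable (c : E ≃ₐ[F] E) (N M : ℕ) {n : ℕ} (e : Fin N × Fin M ≃ Fin n)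
variable (JV : Matrix (Fin N) (Fin N) E) (JW : Matrix (Fin M) (Fin M) E)
variable {TV : Matrix (Fin N) (Fin N) F} {TW : Matrix (Fin M) (Fin M) F}
variable [Algebra.IsQuadraticExtension F E] {δ : E} (hcδ : c δ = -δ) (hδ : δ ≠ 0) {d : F}
  (hd : δ * δ = algebraMap F E d) (hV : TV.IsSymm) (hW : TW.IsSymm) (hVd : IsUnit TV.det) (hWd : IsUnit TW.det)
  (hJV : JV = TV.map (algebraMap F E)) (hJW : JW = TW.map (algebraMap F E))
  (𝓢 : LocalSplitting.FinLocalSplittings F E c n hcδ hδ hd (gram F e TV TW) (isSymm_gram F e hV hW)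
    (reindex_kronecker_eq_gram_map F E e hJV hJW))
  {s : UnitaryGroup.adelicPair F E c N M JV JW →* adelicMpCont F (Fin n) (adelicGram F e TV TW)}
  (hs : (splittingDatum F E c N M e JV JW hcδ hδ hd hV hW hVd hWd hJV hJW).IsCompatible s)

/-- **the local reference section is continuous** (coefficient topology on `Mp_ψ(𝕎_𝔸)ᶜᵒⁿᵗ`): `finPairEmb`,
`𝓢.finSplitting` (`continuous_finSplitting`), `relabel`, `reindex_e⁻¹` are. [cite: GelbartRogawski1991, §3.1 Prop. 3.1.1 p. 455 L1–3] -/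
theorem continuous_localRefSection : Continuous (localRefSection F E c N M e JV JW hcδ hδ hd hV hW hJV hJW 𝓢) :=
  (continuous_adelicMpContReindex_symm F e _).comp ((continuous_adelicMpContRelabel F (Fin n) 1 (adelicGram_mul_one F e)).comp
    (𝓢.continuous_finSplitting.comp (continuous_finPairEmb F E c N M e JV JW)))

include hs in
/-- **the twist character against the local reference section exists and is continuous** (along a continuous pair
splitting): `pairSmall₁ s ∘ finPairToAdelic = s₀ ⊗ χ`, `s₀ = localRefSection 𝓢`.
[cite: GelbartRogawski1991, §3.1 Remark p. 457 L4–13] -/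
theorem exists_twist_localRefSection_continuous (hsc : Continuous (pairSplitting F E c N M e JV JW s)) :
    ∃ χ : UnitaryGroup.finAdelic F E c N JV × UnitaryGroup.finAdelic F E c M JW →* ℂˣ, Continuous χ ∧
      (pairSmall₁ F E c N M e JV JW s).comp (finPairToAdelic F E c N M JV JW) =
        adelicMpCont.twist F (Fin N × Fin M) _ (localRefSection F E c N M e JV JW hcδ hδ hd hV hW hJV hJW 𝓢) χ :=
  exists_eq_twist_finPairSection_continuous F E c N M e JV JW hVd hWd _
    (proj_localRefSection_eq F E c N M e JV JW hcδ hδ hd hV hW hVd hWd hJV hJW 𝓢 hs) hsc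
    (continuous_localRefSection F E c N M e JV JW hcδ hδ hd hV hW hJV hJW 𝓢)

variable {χ : UnitaryGroup.finAdelic F E c N JV × UnitaryGroup.finAdelic F E c M JW →* ℂˣ}
  (hχ : (pairSmall₁ F E c N M e JV JW s).comp (finPairToAdelic F E c N M JV JW) =
    adelicMpCont.twist F (Fin N × Fin M) _ (localRefSection F E c N M e JV JW hcδ hδ hd hV hW hJV hJW 𝓢) χ)
  {χ' χ'' : UnitaryGroup.finAdelic F E c M JW →* ℂˣ} (hχ' : ∀ u, χ' u = χ (1, u) * χ'' u)

include hχ hχ' in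
/-- **`Ω(s, χ')` is irreducible iff the place-assembled coinvariants are.**  For a compatible splitting `s` of the pair
datum, local splittings `𝓢` of the big group, the twist `χ` with `pairSmall₁ s ∘ finPairToAdelic = s₀ ⊗ χ` (`s₀ =
localRefSection 𝓢`) and `χ' = χ(1,·)·χ''`: the `U(J_V)(𝔸_{F,f})`-representation `weilCoinv χ' hs` on `Ω(s, χ')` is irreducible
iff the action `k ↦ Ω(reindex (k ⊗ 1))` on the `χ''`-coinvariants of `u ↦ Ω(reindex (1 ⊗ u))` on `𝒮((𝔸_F^∞)^n)` is
(`isIrreducible_weilCoinv_iff_reference` + transport along `R_e = finSBReindex F e`, `finRepMp_localRefSection_apply`).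
[cite: GelbartRogawski1991, §3.1 Remark p. 457 L4–13; Liu2021, Def. 4.11 (l. 2092–2096)] -/
theorem isIrreducible_weilCoinv_iff_omega_finPairEmb :
    (weilCoinv F E c N M e JV JW hcδ hδ hd hV hW hVd hWd hJV hJW χ' hs).IsIrreducible ↔
      (TwistedCoinv.rep χ''
        (show Representation ℂ (UnitaryGroup.finAdelic F E c N JV) _ from
          𝓢.Omega.comp ((finPairEmb F E c N M e JV JW).comp (MonoidHom.inl _ _)))
        (commute_omega_finPairEmb F E c N M e JV JW hcδ hδ hd hV hW hJV hJW 𝓢)).IsIrreducible := by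
  refine (isIrreducible_weilCoinv_iff_reference F E c N M e JV JW hcδ hδ hd hV hW hVd hWd hJV hJW
    (proj_localRefSection_eq F E c N M e JV JW hcδ hδ hd hV hW hVd hWd hJV hJW 𝓢 hs) hχ hs hχ').trans ?_
  refine TwistedCoinv.isIrreducible_rep_iff_of_mapEquiv _ χ'' _ χ'' _ _ _ _ (finSBReindex F e) (fun _ => 1)
    (fun u f => ?_) (fun u => (one_mul _).symm) (MonoidHom.id _) Function.surjective_id (fun _ => 1) (fun k f => ?_)
  · -- `Ω(reindex (1 ⊗ u)) (R_e f) = R_e (ω_f^{s₀}(1, u) f)`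
    rw [Units.val_one, one_smul]
    change 𝓢.Omega (finPairEmb F E c N M e JV JW (1, u)) (finSBReindex F e f) =
      finSBReindex F e (finRepMp (isUnit_kronecker_map F N hVd hWd) (localRefSection F E c N M e JV JW hcδ hδ hd hV hW hJV hJW 𝓢)
        (harch_localRefSection F E c N M e JV JW hcδ hδ hd hV hW hVd hWd hJV hJW 𝓢 hs) (1, u) f)
    rw [finRepMp_localRefSection_apply F E c N M e JV JW hcδ hδ hd hV hW hVd hWd hJV hJW 𝓢 hs, LinearEquiv.apply_symm_apply]
  · rw [Units.val_one, one_smul, MonoidHom.id_apply]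
    change 𝓢.Omega (finPairEmb F E c N M e JV JW (k, 1)) (finSBReindex F e f) =
      finSBReindex F e (finRepMp (isUnit_kronecker_map F N hVd hWd) (localRefSection F E c N M e JV JW hcδ hδ hd hV hW hJV hJW 𝓢)
        (harch_localRefSection F E c N M e JV JW hcδ hδ hd hV hW hVd hWd hJV hJW 𝓢 hs) (k, 1) f)
    rw [finRepMp_localRefSection_apply F E c N M e JV JW hcδ hδ hd hV hW hVd hWd hJV hJW 𝓢 hs, LinearEquiv.apply_symm_apply]

end General

/-! ## §2 Lines: the acting group is the centre `E¹(𝔸_{F,f})` -/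

section Line

variable (F E : Type) [Field F] [NumberField F] [Field E] [NumberField E] [Algebra F E]
variable (c : E ≃ₐ[F] E) (N : ℕ) {n : ℕ} (e : Fin N × Fin 1 ≃ Fin n)
variable (JV : Matrix (Fin N) (Fin N) E) (JW : Matrix (Fin 1) (Fin 1) E)
variable {TV : Matrix (Fin N) (Fin N) F} {TW : Matrix (Fin 1) (Fin 1) F}
variable [Algebra.IsQuadraticExtension F E] {δ : E} (hcδ : c δ = -δ) (hδ : δ ≠ 0) {d : F}
  (hd : δ * δ = algebraMap F E d) (hV : TV.IsSymm) (hW : TW.IsSymm) (hVd : IsUnit TV.det) (hWd : IsUnit TW.det)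
  (hJV : JV = TV.map (algebraMap F E)) (hJW : JW = TW.map (algebraMap F E))
  (𝓢 : LocalSplitting.FinLocalSplittings F E c n hcδ hδ hd (gram F e TV TW) (isSymm_gram F e hV hW)
    (reindex_kronecker_eq_gram_map F E e hJV hJW))
  {s : UnitaryGroup.adelicPair F E c N 1 JV JW →* adelicMpCont F (Fin n) (adelicGram F e TV TW)}
  (hs : (splittingDatum F E c N 1 e JV JW hcδ hδ hd hV hW hVd hWd hJV hJW).IsCompatible s)
  {χ : UnitaryGroup.finAdelic F E c N JV × UnitaryGroup.finAdelic F E c 1 JW →* ℂˣ}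
  (hχ : (pairSmall₁ F E c N 1 e JV JW s).comp (finPairToAdelic F E c N 1 JV JW) =
    adelicMpCont.twist F (Fin N × Fin 1) _ (localRefSection F E c N 1 e JV JW hcδ hδ hd hV hW hJV hJW 𝓢) χ)
  {χ' χ'' : UnitaryGroup.finAdelic F E c 1 JW →* ℂˣ} (hχ' : ∀ u, χ' u = χ (1, u) * χ'' u)

/-- the `U(J_V)`-member of `Ω ∘ finPairEmb` commutes with the centre `Ω ∘ (u ↦ u·1_n)`. [cite: Mok2014, §1 Notation p. 5] -/
theorem commute_omega_finPairEmb_finAdelicCenter (k : UnitaryGroup.finAdelic F E c N JV)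
    (u : UnitaryGroup.finAdelicOne F E c) :
    Commute ((show Representation ℂ (UnitaryGroup.finAdelic F E c N JV) _ from
        𝓢.Omega.comp ((finPairEmb F E c N 1 e JV JW).comp (MonoidHom.inl _ _))) k)
      ((show Representation ℂ (UnitaryGroup.finAdelicOne F E c) _ from
        𝓢.Omega.comp (UnitaryGroup.finAdelicCenter F E c n (Matrix.reindex e e (JV ⊗ₖ JW)))) u) := by
  change Commute (𝓢.Omega (finPairEmb F E c N 1 e JV JW (k, 1)))
    (𝓢.Omega (UnitaryGroup.finAdelicCenter F E c n (Matrix.reindex e e (JV ⊗ₖ JW)) u))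
  exact (show Commute (finPairEmb F E c N 1 e JV JW (k, 1))
      (UnitaryGroup.finAdelicCenter F E c n (Matrix.reindex e e (JV ⊗ₖ JW)) u) from
    (UnitaryGroup.finAdelicCenter_mul_comm F E c n (Matrix.reindex e e (JV ⊗ₖ JW)) u
      (finPairEmb F E c N 1 e JV JW (k, 1))).symm).map 𝓢.Omega

include hχ hχ' in
/-- **For a line `W`: `Ω(s, χ')` is irreducible iff the `U(J_V)(𝔸_f)`-action on «the maximal quotient of `Ω` on which
the CENTRE `E¹(𝔸_{F,f})` acts by `χ'' ∘ (u ↦ u·1_W)`» is irreducible** — the `U(J_W)`-member of the pair is the centre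
(`finPairEmb_one_finAdelicCenter`, `finAdelicCenter_surjective_one`; `TwistedCoinv.isIrreducible_rep_iff_of_comp_surjective_right`).
This is [Liu2021, App. D §D.1 Step 3]'s «maximal quotient … with central character `χ`» on the place-assembled carrier.
[cite: Liu2021, App. D §D.1 Step 3 (l. 5221), Def. 4.11 (l. 2092–2096); GelbartRogawski1991, §3.1 Remark p. 457 L4–13] -/
theorem isIrreducible_weilCoinv_iff_omega_center (hJW0 : JW 0 0 ≠ 0) :
    (weilCoinv F E c N 1 e JV JW hcδ hδ hd hV hW hVd hWd hJV hJW χ' hs).IsIrreducible ↔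
      (TwistedCoinv.rep (χ''.comp (UnitaryGroup.finAdelicCenter F E c 1 JW))
        (show Representation ℂ (UnitaryGroup.finAdelic F E c N JV) _ from
          𝓢.Omega.comp ((finPairEmb F E c N 1 e JV JW).comp (MonoidHom.inl _ _)))
        (commute_omega_finPairEmb_finAdelicCenter F E c N e JV JW hcδ hδ hd hV hW hJV hJW 𝓢)).IsIrreducible := by
  refine (isIrreducible_weilCoinv_iff_omega_finPairEmb F E c N 1 e JV JW hcδ hδ hd hV hW hVd hWd hJV hJW 𝓢 hs hχ
    hχ').trans ?_
  -- pull the acting group back along the surjection `u ↦ u·1_W : E¹(𝔸_f) ↠ U(J_W)(𝔸_f)`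
  have hWrep : (show Representation ℂ (UnitaryGroup.finAdelicOne F E c) _ from
      (show Representation ℂ (UnitaryGroup.finAdelic F E c 1 JW) _ from
        𝓢.Omega.comp ((finPairEmb F E c N 1 e JV JW).comp (MonoidHom.inr _ _))).comp
          (UnitaryGroup.finAdelicCenter F E c 1 JW)) =
      (show Representation ℂ (UnitaryGroup.finAdelicOne F E c) _ from
        𝓢.Omega.comp (UnitaryGroup.finAdelicCenter F E c n (Matrix.reindex e e (JV ⊗ₖ JW)))) := by
    refine MonoidHom.ext fun u => ?_
    change 𝓢.Omega (finPairEmb F E c N 1 e JV JW (1, UnitaryGroup.finAdelicCenter F E c 1 JW u)) =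
      𝓢.Omega (UnitaryGroup.finAdelicCenter F E c n (Matrix.reindex e e (JV ⊗ₖ JW)) u)
    rw [finPairEmb_one_finAdelicCenter]
  rw [← TwistedCoinv.isIrreducible_rep_iff_of_comp_surjective_right _ χ'' (UnitaryGroup.finAdelicCenter F E c 1 JW)
    (UnitaryGroup.finAdelicCenter_surjective_one F E c JW hJW0) _
    (commute_omega_finPairEmb F E c N 1 e JV JW hcδ hδ hd hV hW hJV hJW 𝓢)
    (fun k u => by
      rw [hWrep]
      exact commute_omega_finPairEmb_finAdelicCenter F E c N e JV JW hcδ hδ hd hV hW hJV hJW 𝓢 k u)]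
  -- the two coinvariant spaces are the quotients by the same submodule (`hW`)
  exact Representation.isIrreducible_iff_of_equivariant _ _ (MonoidHom.id _) Function.surjective_id
    (Submodule.quotEquivOfEq _ _ (by rw [hWrep])) fun k x => by
      obtain ⟨v, rfl⟩ := TwistedCoinv.mk_surjective _ _ x
      rfl

end Line

end Literature.NumberTheory.GelbartRogawski1991.UnitaryDualPair.WeilCoinv

/-! ## §3 [Liu2021, Def. 4.11]'s `rho … ι ε χ`: irreducibility from the place-assembled Weil representation -/

section Liu

open Literature.NumberTheory Literature.NumberTheory.Automorphic
open Literature.NumberTheory.GelbartRogawski1991 Literature.NumberTheory.GelbartRogawski1991.UnitaryDualPair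
open Literature.NumberTheory.GelbartRogawski1991.UnitaryDualPair.WeilCoinv

namespace Literature.NumberTheory.Automorphic.Liu2021.Def411WeilCarriers

variable (F E : Type) [Field F] [NumberField F] [Field E] [NumberField E] [Algebra F E]
variable (c : E ≃ₐ[F] E) (N : ℕ) {n : ℕ} (e : Fin N × Fin 1 ≃ Fin n)
variable (JV : Matrix (Fin N) (Fin N) E) {TV : Matrix (Fin N) (Fin N) F}
variable [Algebra.IsQuadraticExtension F E] {δ : E} (hcδ : c δ = -δ) (hδ : δ ≠ 0) {d : F}
  (hd : δ * δ = algebraMap F E d) (hV : TV.IsSymm) (hVd : IsUnit TV.det) (hJV : JV = TV.map (algebraMap F E))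
variable {s : ∀ a : Fˣ, UnitaryGroup.adelicPair F E c N 1 JV (JW F E a) →* adelicMpCont F (Fin n) (adelicGram F e TV (TW F a))}
  (hs : ∀ a : Fˣ, (splittingDatum F E c N 1 e JV (JW F E a) hcδ hδ hd hV (isSymm_TW F a) hVd (isUnit_det_TW F a) hJV
    (JW_eq F E a)).IsCompatible (s a))
  (hsc : ∀ a : Fˣ, Continuous (pairSplitting F E c N 1 e JV (JW F E a) (s a)))
variable (ε : Eps F d) (χ : Chi F E c)
/- THE LOCAL DATA at the line of `ε`: local splittings of `U(J_V ⊗ (lineOf ε))(F_v)` (Liu's `ι_{μ_v}` for `V_{ε_v}`). -/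
variable (𝓢 : LocalSplitting.FinLocalSplittings F E c n hcδ hδ hd (gram F e TV (TW F (lineOf F d ε)))
    (isSymm_gram F e hV (isSymm_TW F (lineOf F d ε)))
    (reindex_kronecker_eq_gram_map F E e hJV (JW_eq F E (lineOf F d ε))))
variable {G : Type*} [Group G] [TopologicalSpace G] {ι : G →* UnitaryGroup.finAdelic F E c N JV}
  (hι : Function.Surjective ι)

omit [TopologicalSpace G] in
include hsc hι in
/-- **`hirr` from the place-assembled Weil representation of `U(V ⊗ ⟨lineOf ε⟩)`.**  Let `s` be a compatible, continuous
splitting family of the pair data `(V, ⟨a⟩)`, `𝓢` local splittings of the big group `U(J_V ⊗ (a))`, `a = lineOf ε`, and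
`ι : G →* U(J_V)(𝔸_{F,f})` onto.  IF for every continuous character `χ₁` of the centre `E¹(𝔸_{F,f})` the
`U(J_V)(𝔸_{F,f})`-action `k ↦ Ω(reindex (k ⊗ 1))` on the maximal quotient of `Ω = ⊗'_v ω_v` (on `𝒮((𝔸_F^∞)^n)`) where the
centre acts by `χ₁` is irreducible — [Liu2021, Def. 4.11 / Lem. D.1 (l. 5227)]'s «irreducible», read on the place-assembled
carrier — THEN `rho … ι ε χ = ω(μ, ε, χ)` is irreducible.  (The twist between `s` and the local reference section is a
continuous character and drops out: `rho_isIrreducible_iff_reference`, `isIrreducible_weilCoinv_iff_omega_center`.)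
[cite: Liu2021, Def. 4.11 (l. 2092–2096), App. D §D.1 Step 3 (l. 5221), Lem. D.1 (l. 5227; (1) l. 5229 for non-vanishing); GelbartRogawski1991, §3.1 Remark p. 457 L4–13] -/
theorem rho_isIrreducible_of_omega_center
    (hirrΩ : ∀ χ₁ : UnitaryGroup.finAdelicOne F E c →* ℂˣ, Continuous χ₁ →
      (TwistedCoinv.rep χ₁
        (show Representation ℂ (UnitaryGroup.finAdelic F E c N JV) _ from
          𝓢.Omega.comp ((finPairEmb F E c N 1 e JV (JW F E (lineOf F d ε))).comp (MonoidHom.inl _ _)))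
        (commute_omega_finPairEmb_finAdelicCenter F E c N e JV (JW F E (lineOf F d ε)) hcδ hδ hd hV (isSymm_TW F _)
          hJV (JW_eq F E _) 𝓢)).IsIrreducible) :
    (rho F E c N e JV hcδ hδ hd hV hVd hJV hs ι ε χ).IsIrreducible := by
  -- the twist between `s_{lineOf ε}` and the local reference section, continuous
  obtain ⟨χtw, hχtwc, hχtw⟩ := exists_twist_localRefSection_continuous F E c N 1 e JV (JW F E (lineOf F d ε)) hcδ hδ hd
    hV (isSymm_TW F _) hVd (isUnit_det_TW F _) hJV (JW_eq F E _) 𝓢 (hs (lineOf F d ε)) (hsc (lineOf F d ε))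
  refine (Representation.isIrreducible_comp_iff_of_surjective _ ι hι).2 ?_
  refine (isIrreducible_weilCoinv_iff_omega_center F E c N e JV (JW F E (lineOf F d ε)) hcδ hδ hd hV (isSymm_TW F _)
    hVd (isUnit_det_TW F _) hJV (JW_eq F E _) 𝓢 (hs (lineOf F d ε)) hχtw
    (χ'' := (χtw.comp (MonoidHom.inr _ _))⁻¹ * lineChar F E c (lineOf F d ε) χ.1) (fun u => ?_)
    (JW_apply_ne_zero F E _)).2 (hirrΩ _ ?_)
  · rw [MonoidHom.mul_apply, MonoidHom.inv_apply, MonoidHom.comp_apply, MonoidHom.inr_apply, ← mul_assoc,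
      mul_inv_cancel, one_mul]
  · -- continuity of `u ↦ χtw(1, u·1_W)⁻¹ · χ(u)`
    have h1 : Continuous fun u : UnitaryGroup.finAdelicOne F E c =>
        χtw (1, UnitaryGroup.finAdelicCenter F E c 1 (JW F E (lineOf F d ε)) u) :=
      hχtwc.comp (continuous_const.prodMk (continuous_finAdelicCenter F E c 1 _))
    have h2 : Continuous fun u : UnitaryGroup.finAdelicOne F E c => χ.1 u := χ.2.1
    refine ((h1.inv).mul h2).congr fun u => ?_
    simp only [Pi.mul_apply, Pi.inv_apply, MonoidHom.comp_apply, MonoidHom.mul_apply, MonoidHom.inv_apply,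
      MonoidHom.inr_apply, lineChar_finAdelicCenter]

end Literature.NumberTheory.Automorphic.Liu2021.Def411WeilCarriers

end Liu

end
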